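import Literature.MathematicalPhysics.QuantumFieldTheory.Balaban1983to89.B9Thm33DeltaAAtKnitLetterOfRegYP335
import Literature.MathematicalPhysics.QuantumFieldTheory.Balaban1983to89.B9B8KnitLetterProjectionC
import Literature.MathematicalPhysics.QuantumFieldTheory.Balaban1983to89.B9SectionCarryingMembersV1

/-!
# `Balaban1983to89.B9Thm32Conv348AtKnitLetterOfRegYP335` — T. Bałaban, *Propagators for lattice gauge theories in a background field*, Commun. Math. Phys. **99**
# (1985) 389–434 [Balaban1985BackgroundPropagators], THEOREM 3.2 (3.48) p. 398 (the block estimate of `(Q′G′²Q′*)⁻¹`, read on the inverse in [4]'s (2.86) currency as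
# (3.96) p. 411 does) FOR THE LETTER
# `C_K = (Q′_K G′_K² Q′*_K)⁻¹` AT PRINT's OWN KNIT TRANSPORTERS `parKnitY` ((3.19) p. 393 «(52), (53) in [5]»), ON PRINT's CLASS (3.35) p. 396, FOR EVERY
# SECTION-CARRYING MEMBER ABOVE ONE THRESHOLD — the N06 knit certificate's ROWS 15–16 display `h348` at the knit record (`Thm/…N06AtOpsYSectEStKnitPairKA`,
# `…N06AtOpsYNuOfRecordV11KSEPairKB`: `Conv348Blk (oneCubeOps39 (geo9Y x) (bg9YR …) (blk39F … (bI x)) (L39 x.toKIdx (parKnitY x.toKIdx) (GpY … (parKnitY …)))) B₃₉ δ₃₉ U`)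
# in its own currency, with no displayed law

statement-level skeleton of published theorems with citation tags; proofs where landed; nothing here is a claim about the Yang–Mills mass gap

THE PRINT.  Thm 3.2 (3.48) p. 398; (3.95)–(3.96) p. 411 («(Q′G′²Q′*)⁻¹ = C₀(I − R)⁻¹ … convergent in the weighted supremum norm on 𝔅 appearing in (3.48)»); (3.25)
p. 395 (the letter `Q′G′²Q′*`, p. 395 «hence the existence of the operator R»); (3.19) p. 393 (the knit transporters); Thm 3.1 (3.42) p. 397; (3.35)–(3.37) p. 396;
(3.69) p. 404; Cor. 3.6 p. 408; Thm 3.11 p. 416 («the operators Δ′_a, G′, (Q′G′²Q′\*)⁻¹ … are positive definite»); [4] Prop. 2.2 (2.50)–(2.52) p. 232, Lemma 2.1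
(2.59)–(2.63) pp. 233–234, (2.66)–(2.67) p. 234, (2.86) p. 238; [5] Prop. 2 (52)–(53) p. 26, (44) p. 24.

WHY THIS FILE (cell `pub-ymgap`, node N06, seat `dag-n06-j` gen 37 = bundle F5 rows 15–16 at the knit record).  After director-ym №383 «CASCADE-K» the N06 certificate
reads its letters at print's KNIT averaging transporters `parKnitY`; its rows-15∕16 display `h348` (Thm 3.9 ⇒ Thm 3.2's (3.48) for the genuine `L = Q′G′²Q′*`) is
therefore asked AT `parKnitY`, over every member.  The tree supplies that display only at def-Y's straight transporter `parSymY` (this seat's g31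
`B9Conv348OfRegYP335AtLettersY.conv348_oneCubeYF_of_regYR_section`, g32 `B9Thm39FacesAlongSubfamilyRC`).  The g36 chain «Thm 3.3's block at `parKnitY` on (3.35)»
carries, as an intermediate never exported at member level, exactly the missing estimate: file 5 `B9B8KnitBondCLettersAtParsReg335.hasMajorant_conj_XinvY_parKnitY_of_data_reg335`
= (3.48) for `X(U; parKnitY)⁻¹` ON THE LOCAL CLASS (3.35) in [4]'s block-majorant currency, from def-Y's-side data (Thm 3.1 for `G′(U; parSymY)`, Thm 3.2 for
`X(U; parSymY)⁻¹`) through the level-weighted block-diagonal letter `E` and two windows.  THIS FILE packages it at the member, exactly as ✓`B9Thm33DeltaAAtKnitLetterOfRegYP335`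
packages the `Δ_a` block (same cube datum of the class on the balls `NearC_□(35S_j∕8 + 1)`, same suppliers FILE 9 `eBlock_GpY_of_cubeData_unitary` +
`symData_of_eBlockS` and FILE 10-D `cinv_at_member_of_cubeData_thmD`, same junction parameter `α₀′ := a₀K` fixed below [5]'s `α_Q` and the two windows of
`B9Thm33KnitJunctionWindows`, same knit numerics folded into the guard, same rate ladder and [4] Lemma 2.1 calls above one threshold — WITHOUT the `Δ_a`-level tail),
and reads the result back through the rows-15∕16 dictionary of g31 (`realify39 = conj`, `unit39 = η⁴`, the faithful representative section `rep39F (bI x)` of a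
surjective `β`), the two-sided inverse of `L39(U; parKnitY)` coming from p. 395 at the knit letter (J-B ∕ n06-l `B9B8KnitLetterProjectionC.isUnit_XY_parKnitY` with
n06-l's `parKnitY_mem_unitary_of_reg335P` on (3.35)).  Every real constant of the assembly is an opaque atom with a defining equation (`maxHeartbeats 2000000` for the
one long assembly — half the budget of the `Δ_a` assembly; the atoms' `positivity` calls exceed the default).

WHAT IS PROVED (sorry-free; 0 `def`).
* §0 ★ `invL39_parKnitY_two_sided_of_reg335P` — on (3.35) (with the knit numerics) `realify39 b (unit39⁻¹ • X(U; parKnitY)⁻¹)` is a two-sided inverse of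
  `L39(U; parKnitY)`.
* §1 ★★★ **`conv348_oneCube_parKnitY_of_regYP335_section`** — `∃ M₁ a₁ B₀ δ₀ > 0, ∀ bI (hβI) x, Surjective β → M₁ ≤ M → ∀ α₀ > 0, c₃₅·M·α₀ ≤ a₁ →
  ∀ U ∈ (bg9YP 𝕄 SU(N) x).Reg335 c₃₅ α₀, Conv348Blk (oneCubeOps39 (geo9Y x) (bg9YP … x) (blk39F … (bI x)) (L39 x.toKIdx (parKnitY x.toKIdx) (GpY x.toKIdx (parKnitY x.toKIdx)))) B₀ δ₀ U`.
* §2 ★★★ **`conv348_oneCube_parKnitY_of_regYR_section`** — the same at the certificate's R-generic premise `(bg9YR … R₁ R₂ x).Reg335 c α₀ U` through its displayed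
  class transfer `hRP1` (`0 < c`, guard `c·M·α₀ ≤ a₁`): «KA»'s binder `h348` VERBATIM at `(𝔏 x).Gp = GpY x (parKnitY x)` for every section-carrying member;
  `conv348_oneCube_parKnitY_at_scMemberY_of_regYR` — along n06-c's carrier `SCMemberY` by name; `conv348_oneCube_parKnitY_of_regYR_section_letters` — at a
  letters family `𝔏` with the pin `(𝔏 x).Gp = GpY x.toKIdx (parKnitY x.toKIdx)` (the certificate's literal `L39 x.toKIdx (parKnitY x.toKIdx) (𝔏 x).Gp`).
HONEST SCOPE.  COMPOSITION of landed theorems with threshold ∕ rate ∕ window bookkeeping; no estimate of [B9] newly asserted; (3.48) for the inverse letter only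
(what rows 15–16 consume), not (3.42)–(3.47); members WITHOUT a section (inner corners, `Node00.OpsYSiteIndexOfRecord.not_forall_memberY_sIK_section_record`) are
outside — the certificate's display over ALL members is NOT discharged by this file; DESIGN constants; count-neutral; NOT a node discharge; nothing continuum ∕ OS ∕
mass gap ∕ Clay — the Yang–Mills mass gap is NOT proved here.  No `sorry`, no `axiom`, no `instance`, no `notation`, no `def`.  NEW file.
RELATED, NOT DUPLICATED (searched 2026-08-30: `rg -l -w "Conv348AtKnitLetter|conv348_oneCube_parKnitY"` over `lean/{Literature,Summits,HarnessLib}` = ∅; `Conv348Blk`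
∧ `parKnitY` co-occur only in consumers): g31 `B9Conv348OfRegYP335AtLettersY` (the display at `parSymY`, its dictionary USED), g36 `B9Thm33DeltaAAtKnitLetterOfRegYP335`
(the `Δ_a` block at `parKnitY`; its §0 helpers USED), lit-balaban `B9KnitMajorantsOfCubeData` ∕ J-B `B9B8KnitLetterCinvTransfer` ((3.48) at the knit letter under the GLOBAL
(52), constant-level torus members), n06-d `B9Thm39FacesAtLettersRCPar` (the consumer-side reader at `parA := parKnitY`, displays `h348`).
-/

noncomputable section

namespace Literature.MathematicalPhysics.QuantumFieldTheory.Balaban1983to89.B9Thm32Conv348AtKnitLetterOfRegYP335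

open Literature.MathematicalPhysics.QuantumFieldTheory.Balaban1983to89
open B6RandomWalk B9Thm39WholeBlk B9Thm39ReadingCoords B9Thm39ReadingAtLetters B9Thm39OneCubeReadingAtLettersY Node00
open B6KLevelCensusIndexV1 B6Ineq2142KLevelV1 B6GlobalChartV1 B9PinMembersKLevelV1 B9PinGeometryKLevelV1 B9GeoNormsKLevelV1
  B9BackgroundsKLevelV1 B9BackgroundsKLevelV1P B9BackgroundsKLevelV1R B9Thm34Ext B9Conv348OfRegYP335AtLettersY B9Thm310DeltaAIsUnitOfRegYP335AtLettersY
  B9Thm33DeltaAAtKnitLetterOfRegYP335 B9SectionCarryingMembersV1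
open Literature.MathematicalPhysics.QuantumFieldTheory.Balaban1983to89.B6MultiLevelBoxOperator (bigSide N0)
open Literature.MathematicalPhysics.QuantumFieldTheory.Balaban1983to89.B6Cover236MultiLevelBlocks (cubes)
open Literature.MathematicalPhysics.QuantumFieldTheory.Balaban1983to89.B9Eq335RegularityClasses (Reg335Cube)
open Literature.MathematicalPhysics.QuantumFieldTheory.Balaban1983to89.LatticeNorms (scaleLen)
open Literature.MathematicalPhysics.QuantumFieldTheory.Balaban1983to89.B9Cor36CubeCutoffs (NearC SC)
open Literature.MathematicalPhysics.QuantumFieldTheory.Balaban1983to89.B4PartitionUnity22 (thetaProf D1 D1_nonneg contDiff_thetaProf hasCompactSupport_thetaProf)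
open Literature.MathematicalPhysics.QuantumFieldTheory.Balaban1983to89.B9Ineq349SiteFromConv348 (rep39F blk39F beta_rep39F_beta)
open Literature.MathematicalPhysics.QuantumFieldTheory.Balaban1983to89.B9Thm39OneCubeReadingAtLettersY (geo9Y_M_nonneg)
open Literature.MathematicalPhysics.QuantumFieldTheory.Balaban1983to89.B9Ineq347 (ScaleTransfer)
open Literature.MathematicalPhysics.QuantumFieldTheory.Balaban1983to89.B9Eq352DivFormLetters (conj)
open Literature.MathematicalPhysics.QuantumFieldTheory.Balaban1983to89.B9GeoLemma21KLevelV1 (geo9K_len_pos geo9Y_len_pos)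
open Literature.MathematicalPhysics.QuantumFieldTheory.Balaban1983to89.B9GeoInputsMultiRateKLevelV1 (geo_inputs3_geo9K)
open Literature.MathematicalPhysics.QuantumFieldTheory.Balaban1983to89.B9RWSums347DefiniteFaces (exp261)
open Literature.MathematicalPhysics.QuantumFieldTheory.Balaban1983to89.B9Eq3105FamThreeAtMember (scaleTransfer_len_inv_pow_geo9K)
open Literature.MathematicalPhysics.QuantumFieldTheory.Balaban1983to89.B9Cor36GpCoverBindersUnitary (eBlock_GpY_of_cubeData_unitary exists_cubeData_of_reg335Cubes)
open Literature.MathematicalPhysics.QuantumFieldTheory.Balaban1983to89.B9Thm32CinvAtMemberOfCubeDataThmD (cinv_at_member_of_cubeData_thmD)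
open Literature.MathematicalPhysics.QuantumFieldTheory.Balaban1983to89.B8Thm2TorusCoverOfEBlockSymG (symData_of_eBlockS)
open Literature.MathematicalPhysics.QuantumFieldTheory.Balaban1983to89.B9B8KnitLetterXDiffMajorant (hasMajorant_rate_mono)
open Literature.MathematicalPhysics.QuantumFieldTheory.Balaban1983to89.B9B8KnitBondCLettersAtParsReg335 (hasMajorant_conj_XinvY_parKnitY_of_data_reg335)
open Literature.MathematicalPhysics.QuantumFieldTheory.Balaban1983to89.B9B8KnitLetterProjectionC (isUnit_XY_parKnitY)
open Literature.MathematicalPhysics.QuantumFieldTheory.Balaban1983to89.B9Eq3124HZKnitPairReg335Y (parKnitY_mem_unitary_of_reg335P)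
open Literature.MathematicalPhysics.QuantumFieldTheory.Balaban1983to89.B9Thm33KnitJunctionWindows (le_half_of_le_window window_AK_BX thetaF_le window_KK_B1)
open Literature.MathematicalPhysics.QuantumFieldTheory.Balaban1983to89.B9Eq316AveragingTransposeZd (alphaQ alphaQ_pos C0_mul_alphaQ_le four_mul_alphaQ_le)
open Literature.MathematicalPhysics.QuantumFieldTheory.Balaban1983to89.B9C2FormBoxRegimeY (Kpl)
open Literature.MathematicalPhysics.QuantumFieldTheory.Balaban1983to89.B9B8AveragingJunction (parKnitY)
open B7Prop2SpecialUnitary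
open scoped Matrix.Norms.L2Operator

/-! ## §0 The two-sided inverse of `L39(U) = realify39 (unit39 • Q′G′²Q′*)(U)` at the KNIT letter on (3.35) -/

section KnitInverse

variable {d ℓ : ℕ} {hd : 1 ≤ d + 1} {hL : Odd (ℓ + 1) ∧ 1 < ℓ + 1} {b₀ b₁ : ℝ} {N : ℕ}

/-- ★ **`L39(U; parKnitY)` HAS THE TWO-SIDED INVERSE `realify39 basis39 (unit39⁻¹ • (Q′G′²Q′*)⁻¹(U; parKnitY))`** for every `SU(N)`-valued `U` of print's class
(3.35) within the knit numerics (`C₀α₀′ ≦ ⅓`, `2α₀′ ≦ c₂′`, `K_pl(Mα₀)L⁴ < α₀′`): p. 395's positivity of `Q′G′²Q′*` at the knit letter (`isUnit_XY_parKnitY`, the knit legs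
being unitary on the class by `parKnitY_mem_unitary_of_reg335P`) read through the multiplicative dictionary.
[cite: Balaban1985BackgroundPropagators, p.395 + Thm 3.11 p.416 + (3.25) p.395 + (3.96) p.411 + (3.19) p.393 + (3.35) p.396; Balaban1985Averaging, (52)–(53) p.26] -/
theorem invL39_parKnitY_two_sided_of_reg335P [Nonempty (Fin N)] (i : KIdx d ℓ hd hL b₀ b₁)
    {U : CfgY (Matrix (Fin N) (Fin N) ℂ) i} {c₀ α₀ : ℝ} (hc : c₀ ≤ 10) (hMα : 0 ≤ (kGeo i).M * α₀)
    (hreg : (bg9KP (Matrix (Fin N) (Fin N) ℂ) (specialUnitaryUnits (Fin N)) i).Reg335 c₀ α₀ U) {α₀' : ℝ} (hα' : 0 < α₀')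
    (hα3 : B7Prop2Explicit.C0 (d + 1) * α₀' ≤ 1 / 3) (hα2 : 2 * α₀' ≤ B7Prop2Explicit.c2' (d + 1) (ℓ + 1))
    (hK : Kpl i ((kGeo i).M * α₀) * (kGeo i).L ^ 4 < α₀') :
    realify39 (basis39 (Matrix (Fin N) (Fin N) ℂ)) ((((unit39 i)⁻¹ : ℝ) : ℂ) • XinvY i (parKnitY i) (GpY i (parKnitY i)) U) *
        L39 i (parKnitY i) (GpY i (parKnitY i)) U = 1 ∧
      L39 i (parKnitY i) (GpY i (parKnitY i)) U *
        realify39 (basis39 (Matrix (Fin N) (Fin N) ℂ)) ((((unit39 i)⁻¹ : ℝ) : ℂ) • XinvY i (parKnitY i) (GpY i (parKnitY i)) U) = 1 := by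
  have hGU : specialUnitaryUnits (Fin N) ≤ B7Prop2Explicit.unitaryUnits (Matrix (Fin N) (Fin N) ℂ) :=
    B7Prop2SpecialUnitary.specialUnitaryUnits_le_unitaryUnits
  have hG1 : ∀ u : (Matrix (Fin N) (Fin N) ℂ)ˣ, u ∈ specialUnitaryUnits (Fin N) → ‖(u : Matrix (Fin N) (Fin N) ℂ)‖ ≤ 1 :=
    fun u hu => (B9Ineq349SiteFromConv342.contractive_of_mem hGU hu).1
  have hUG : ∀ μ z, U μ z ∈ B7Prop2Explicit.unitaryUnits (Matrix (Fin N) (Fin N) ℂ) := fun μ z => hGU (hreg.1 μ z)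
  have hpar : ∀ z w : SiteY i, parKnitY i U z w ∈ B7Prop2Explicit.unitaryUnits (Matrix (Fin N) (Fin N) ℂ) :=
    parKnitY_mem_unitary_of_reg335P i hG1 hGU U hc hMα hreg hα' hα3 hα2 hK
  have hX := isUnit_XY_parKnitY i le_rfl hUG hpar
  have hu : (((unit39 i : ℝ) : ℂ)) ≠ 0 := by exact_mod_cast (unit39_pos i).ne'
  have h1 : ((((unit39 i)⁻¹ : ℝ) : ℂ) • XinvY i (parKnitY i) (GpY i (parKnitY i)) U) *
      ((((unit39 i) : ℝ) : ℂ) • XY i (parKnitY i) (GpY i (parKnitY i)) U) = 1 := by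
    rw [smul_mul_smul_comm, XinvY, Ring.inverse_mul_cancel _ hX]
    push_cast
    rw [inv_mul_cancel₀ hu, one_smul]
  have h2 : ((((unit39 i) : ℝ) : ℂ) • XY i (parKnitY i) (GpY i (parKnitY i)) U) *
      ((((unit39 i)⁻¹ : ℝ) : ℂ) • XinvY i (parKnitY i) (GpY i (parKnitY i)) U) = 1 := by
    rw [smul_mul_smul_comm, XinvY, Ring.mul_inverse_cancel _ hX]
    push_cast
    rw [mul_inv_cancel₀ hu, one_smul]
  refine ⟨?_, ?_⟩
  · show _ * realify39 _ _ = 1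
    rw [← realify39_mul, h1, realify39_one]
  · show realify39 _ _ * _ = 1
    rw [← realify39_mul, h2, realify39_one]

end KnitInverse

/-! ## §1 ★★★ Rows 15–16's display at the knit letter on (3.35), section-carrying members -/

section Record

variable {N : ℕ} (θ : Stage3Params) (Mstar : ℕ)
variable [∀ x : MemberY θ.d₆ θ.ℓ₆ θ.hd' θ.hL' θ.b₀ θ.b₁ Mstar, Fintype (geo9Y x).Site]

set_option maxHeartbeats 2000000 in
/-- ★★★ **THEOREM 3.2's (3.48) FOR `(Q′G′²Q′*)⁻¹` AT PRINT's KNIT TRANSPORTERS ON PRINT's CLASS (3.35), FOR EVERY SECTION-CARRYING MEMBER ABOVE ONE THRESHOLD** —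
rows 15–16's one display at the knit record: there are `M₁, a₁, B₀, δ₀ > 0` (functions of `d, L, N` only) such that for every bond map `bI` with `β ∘ bI ∘ β = β`
on carrier blocks (`hβI`), every member `x` with `β` onto and `M₁ ≦ M`, every `α₀ > 0` with `c₃₅·M·α₀ ≦ a₁` and every `SU(N)`-valued `U ∈ (bg9YP … x).Reg335 c₃₅ α₀`:
`Conv348Blk (oneCubeOps39 (geo9Y x) (bg9YP … x) (blk39F … (bI x)) (L39 x.toKIdx (parKnitY x.toKIdx) (GpY x.toKIdx (parKnitY x.toKIdx)))) B₀ δ₀ U` — the genuine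
`L39(U; parKnitY) = Q′_K G′_K² Q′*_K(U)` in print's units and real coordinates has a two-sided inverse with block majorant `B₀(Lʲη)⁻⁴e^{−δ₀d}` w.r.t. the faithful
block map.  ROAD: def-Y's-side data (FILE 9 + `symData_of_eBlockS` for `G′(U; parSymY)`, FILE 10-D for `X(U; parSymY)⁻¹`) from the cube datum of the class; file 5
of the g36 chain at `α₀′ := a₀K := min(α_Q, w₁, w₂)` (windows 1–2 of `B9Thm33KnitJunctionWindows`); §0; g31's dictionary.
[cite: Balaban1985BackgroundPropagators, Thm 3.2 (3.48) p.398, (3.95)–(3.96) p.411, (3.25) p.395, (3.19) p.393, (3.35) p.396, Thm 3.1 (3.42) p.397, Cor. 3.6 p.408, (3.69) p.404; Balaban1984PropagatorsII, Prop. 2.2 (2.50)–(2.52) p.232, Lemma 2.1 (2.59)–(2.63) pp.233–234, (2.66)–(2.67) p.234, (2.86) p.238; Balaban1985Averaging, Prop. 2 (52)–(53) p.26, (44) p.24] -/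
theorem conv348_oneCube_parKnitY_of_regYP335_section (hN : 1 ≤ N) :
    ∃ M₁ a₁ B₀ δ₀ : ℝ, 0 < M₁ ∧ 0 < a₁ ∧ 0 < B₀ ∧ 0 < δ₀ ∧
    ∀ (bI : ∀ x : MemberY θ.d₆ θ.ℓ₆ θ.hd' θ.hL' θ.b₀ θ.b₁ Mstar, FBondY x.toKIdx → IBondY x.toKIdx)
      (_hβI : ∀ (x : MemberY θ.d₆ θ.ℓ₆ θ.hd' θ.hL' θ.b₀ θ.b₁ Mstar) (f : FBondY x.toKIdx) (c : IBondY x.toKIdx),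
        blkV1 x.hN x.D f = β x.hN x.D x.hk c → β x.hN x.D x.hk (bI x f) = blkV1 x.hN x.D f)
      (x : MemberY θ.d₆ θ.ℓ₆ θ.hd' θ.hL' θ.b₀ θ.b₁ Mstar), Function.Surjective (β x.hN x.D x.hk) → M₁ ≤ (geo9Y x).M →
      ∀ α₀ : ℝ, 0 < α₀ → c35Y * (geo9Y x).M * α₀ ≤ a₁ →
      ∀ U : CfgY (Matrix (Fin N) (Fin N) ℂ) x.toKIdx,
        (bg9YP (Matrix (Fin N) (Fin N) ℂ) (specialUnitaryUnits (Fin N)) x).Reg335 c35Y α₀ U →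
        Conv348Blk (oneCubeOps39 (geo9Y x) (bg9YP (Matrix (Fin N) (Fin N) ℂ) (specialUnitaryUnits (Fin N)) x)
          (blk39F (Matrix (Fin N) (Fin N) ℂ) x.toKIdx (bI x)) (L39 x.toKIdx (parKnitY x.toKIdx) (GpY x.toKIdx (parKnitY x.toKIdx)))) B₀ δ₀ U := by
  classical
  haveI : NeZero N := ⟨by omega⟩
  haveI : Nonempty (Fin N) := ⟨⟨0, hN⟩⟩
  haveI instK : ∀ i' : KIdx θ.d₆ θ.ℓ₆ θ.hd' θ.hL' θ.b₀ θ.b₁, Fintype (geo9K i').Site := fun i' => (kGeoU i').fin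
  haveI instD : ∀ i' : KIdx θ.d₆ θ.ℓ₆ θ.hd' θ.hL' θ.b₀ θ.b₁, DecidableEq (geo9K i').Site := fun i' => Classical.decEq _
  have hGU : specialUnitaryUnits (Fin N) ≤ B7Prop2Explicit.unitaryUnits (Matrix (Fin N) (Fin N) ℂ) := specialUnitaryUnits_le_unitaryUnits
  have hG1 : ∀ u : (Matrix (Fin N) (Fin N) ℂ)ˣ, u ∈ specialUnitaryUnits (Fin N) → ‖(u : Matrix (Fin N) (Fin N) ℂ)‖ ≤ 1 :=
    fun u hu => (B9Ineq349SiteFromConv342.contractive_of_mem hGU hu).1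
  -- the basis of record and its coordinate bound (an opaque atom `M₂`)
  obtain ⟨M₂, hM₂def⟩ : ∃ t : ℝ, t = coordBound39 (basis39 (Matrix (Fin N) (Fin N) ℂ)) := ⟨_, rfl⟩
  have hM₂ : 0 ≤ M₂ := by rw [hM₂def]; exact norm_nonneg _
  have hrepr : ∀ (v : Matrix (Fin N) (Fin N) ℂ) (j : κ39 (Matrix (Fin N) (Fin N) ℂ)),
      |(basis39 (Matrix (Fin N) (Fin N) ℂ)).repr v j| ≤ M₂ * ‖v‖ :=
    fun v j => by rw [hM₂def]; exact abs_repr_le (basis39 (Matrix (Fin N) (Fin N) ℂ)) v j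
  have hSb : 0 ≤ ∑ j, ‖basis39 (Matrix (Fin N) (Fin N) ℂ) j‖ := Finset.sum_nonneg fun _ _ => norm_nonneg _
  set κ : ℝ := M₂ * ∑ j, ‖basis39 (Matrix (Fin N) (Fin N) ℂ) j‖ with hκdef
  have hκ0 : 0 ≤ κ := mul_nonneg hM₂ hSb
  -- ═══ the two suppliers at def-Y's letter (member-free packages): Thm 3.1 for `G′(U; parSymY)`, Thm 3.2 for `X(U; parSymY)⁻¹` ═══
  obtain ⟨δG, KG, M₀G, T₀G, N₀G, hδG, hKG, a₁G, ha₁G, HG⟩ := eBlock_GpY_of_cubeData_unitary (basis39 (Matrix (Fin N) (Fin N) ℂ)) hGU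
    (fun _ : KIdx θ.d₆ θ.ℓ₆ θ.hd' θ.hL' θ.b₀ θ.b₁ => (0 : ℝ)) (fun _ => True) θ.one_le_ℓ₆ hM₂ hrepr
  obtain ⟨δT, KT, M₀T, T₀T, N₀T, hδT, hKT, a₁T, ha₁T, HT⟩ := cinv_at_member_of_cubeData_thmD (basis39 (Matrix (Fin N) (Fin N) ℂ)) hGU
    (fun _ : KIdx θ.d₆ θ.ℓ₆ θ.hd' θ.hL' θ.b₀ θ.b₁ => (0 : ℝ)) (fun _ => True) θ.one_le_ℓ₆ hM₂ hrepr
  -- ═══ constants ═══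
  set L : ℝ := (θ.ℓ₆ : ℝ) + 1 with hLdef
  have hL1 : 1 ≤ L := by rw [hLdef]; have : (0:ℝ) ≤ θ.ℓ₆ := Nat.cast_nonneg _; linarith
  have hL0 : 0 < L := lt_of_lt_of_le one_pos hL1
  have hlogL : 0 ≤ Real.log L := Real.log_nonneg hL1
  have hPL : 0 ≤ 2 * L ^ 2 - 1 := by nlinarith
  have hPL' : 0 < 2 * L ^ 2 - 1 := by nlinarith
  set Dd : ℝ := ((θ.d₆ : ℝ) + 1) ^ 2 with hDd
  have hDd0 : 0 ≤ Dd := by positivity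
  set A : ℝ := κ * KG with hAdef
  have hA0 : 0 ≤ A := mul_nonneg hκ0 hKG
  -- ═══ the rate ladder (every fraction `¼`, `α_g = ½`); the base rate is an opaque atom ═══
  obtain ⟨δ₀, hδ₀def⟩ : ∃ t : ℝ, t = min δG δT := ⟨_, rfl⟩
  have hδ₀ : 0 < δ₀ := by rw [hδ₀def]; exact lt_min hδG hδT
  have hδ₀G : δ₀ ≤ δG := by rw [hδ₀def]; exact min_le_left _ _
  have hδ₀T : δ₀ ≤ δT := by rw [hδ₀def]; exact min_le_right _ _
  set δ : ℝ := δ₀ / 2 with hδdef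
  set δ₁ : ℝ := (1 - 1 / 4) * ((1 - 1 / 4) * δ) with hδ₁def
  set δ₂ : ℝ := (1 - 1 / 4) * ((1 - 1 / 4) * δ₁) with hδ₂def
  set δ₃ : ℝ := (1 - 1 / 4) * ((1 - 1 / 4) * δ₂) with hδ₃def
  set δc : ℝ := (1 - 1 / 4) * δ₃ / 2 with hδcdef
  set ρ : ℝ := δc / 4 with hρdef
  have hδ : 0 < δ := by positivity
  have hδ₁ : 0 < δ₁ := by positivity
  have hδ₂ : 0 < δ₂ := by positivity
  have hδ₃ : 0 < δ₃ := by positivity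
  have hδc : 0 < δc := by positivity
  have hρ : 0 < ρ := by positivity
  -- ═══ [4] Lemma 2.1 at the rate pairs, above one threshold (two calls) ═══
  obtain ⟨MLA, hgeoA⟩ := geo_inputs3_geo9K (fun _ : KIdx θ.d₆ θ.ℓ₆ θ.hd' θ.hL' θ.b₀ θ.b₁ => (0 : ℝ)) (fun _ => True)
    (δ₁ := δc) (α₁ := 1 / 4) (δ₂ := (1 - 1 / 4) * δ) (α₂ := 1 / 4) (δ₃ := δ₀) (α₃ := 1 / 2)
    (by positivity) (by positivity) (by positivity) hδ₀.le (by norm_num)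
  obtain ⟨MLB, hgeoB⟩ := geo_inputs3_geo9K (fun _ : KIdx θ.d₆ θ.ℓ₆ θ.hd' θ.hL' θ.b₀ θ.b₁ => (0 : ℝ)) (fun _ => True)
    (δ₁ := (1 - 1 / 4) * δ₁) (α₁ := 1 / 4) (δ₂ := (1 - 1 / 4) * δ₂) (α₂ := 1 / 4) (δ₃ := δ₃) (α₃ := 1 / 4)
    (by positivity) (by positivity) (by positivity) hδ₃.le (by norm_num)
  -- the row constants: opaque atoms with defining equations
  obtain ⟨cg, hcgdef⟩ : ∃ c : ℝ, c = B6.c1 (max (exp261 (geo9K (d := θ.d₆) (ℓ := θ.ℓ₆) (hd := θ.hd') (hL := θ.hL') (b₀ := θ.b₀) (b₁ := θ.b₁)) ((1 - 1 / 4) * δ) (1 / 4))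
    (exp261 (geo9K (d := θ.d₆) (ℓ := θ.ℓ₆) (hd := θ.hd') (hL := θ.hL') (b₀ := θ.b₀) (b₁ := θ.b₁)) δ₀ (1 / 2))) δ₀ (1 / 2) := ⟨_, rfl⟩
  obtain ⟨c₁, hc₁def⟩ : ∃ c : ℝ, c = B6.c1 (max (exp261 (geo9K (d := θ.d₆) (ℓ := θ.ℓ₆) (hd := θ.hd') (hL := θ.hL') (b₀ := θ.b₀) (b₁ := θ.b₁)) ((1 - 1 / 4) * δ) (1 / 4))
    (exp261 (geo9K (d := θ.d₆) (ℓ := θ.ℓ₆) (hd := θ.hd') (hL := θ.hL') (b₀ := θ.b₀) (b₁ := θ.b₁)) δ₀ (1 / 2))) ((1 - 1 / 4) * δ) (1 / 4) := ⟨_, rfl⟩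
  obtain ⟨c₂, hc₂def⟩ : ∃ c : ℝ, c = B6.c1 (exp261 (geo9K (d := θ.d₆) (ℓ := θ.ℓ₆) (hd := θ.hd') (hL := θ.hL') (b₀ := θ.b₀) (b₁ := θ.b₁)) ((1 - 1 / 4) * δ₁) (1 / 4))
    ((1 - 1 / 4) * δ₁) (1 / 4) := ⟨_, rfl⟩
  obtain ⟨c₃, hc₃def⟩ : ∃ c : ℝ, c = B6.c1 (max (exp261 (geo9K (d := θ.d₆) (ℓ := θ.ℓ₆) (hd := θ.hd') (hL := θ.hL') (b₀ := θ.b₀) (b₁ := θ.b₁)) ((1 - 1 / 4) * δ₂) (1 / 4))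
    (exp261 (geo9K (d := θ.d₆) (ℓ := θ.ℓ₆) (hd := θ.hd') (hL := θ.hL') (b₀ := θ.b₀) (b₁ := θ.b₁)) δ₃ (1 / 4))) ((1 - 1 / 4) * δ₂) (1 / 4) := ⟨_, rfl⟩
  obtain ⟨c₄, hc₄def⟩ : ∃ c : ℝ, c = B6.c1 (max (exp261 (geo9K (d := θ.d₆) (ℓ := θ.ℓ₆) (hd := θ.hd') (hL := θ.hL') (b₀ := θ.b₀) (b₁ := θ.b₁)) ((1 - 1 / 4) * δ₂) (1 / 4))
    (exp261 (geo9K (d := θ.d₆) (ℓ := θ.ℓ₆) (hd := θ.hd') (hL := θ.hL') (b₀ := θ.b₀) (b₁ := θ.b₁)) δ₃ (1 / 4))) δ₃ (1 / 4) := ⟨_, rfl⟩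
  have hcg0 : 0 ≤ cg := by rw [hcgdef]; exact c1_nonneg _ _ _
  have hc₁0 : 0 ≤ c₁ := by rw [hc₁def]; exact c1_nonneg _ _ _
  have hc₂0 : 0 ≤ c₂ := by rw [hc₂def]; exact c1_nonneg _ _ _
  have hc₃0 : 0 ≤ c₃ := by rw [hc₃def]; exact c1_nonneg _ _ _
  have hc₄0 : 0 ≤ c₄ := by rw [hc₄def]; exact c1_nonneg _ _ _
  -- ═══ the starred atoms, the two windows and the fixed junction parameter `a₀K` (all opaque) ═══
  obtain ⟨AKs, hAKsdef⟩ : ∃ t : ℝ, t = 2 * A * cg := ⟨_, rfl⟩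
  obtain ⟨Fs, hFsdef⟩ : ∃ t : ℝ, t = (2 * (8 * Dd) * κ) * κ * (A * A * L ^ 2 * c₁)
      + κ * κ * ((A + AKs) * (AKs * ((32 * Dd * κ) * A) * L ^ 2 * c₁) * L ^ 2 * c₂) + κ * (2 * (8 * Dd) * κ) * (AKs * AKs * L ^ 2 * c₁) := ⟨_, rfl⟩
  have hAKs0 : 0 ≤ AKs := by rw [hAKsdef]; positivity
  have hFs0 : 0 ≤ Fs := by rw [hFsdef]; positivity
  obtain ⟨w₁, hw₁def⟩ : ∃ t : ℝ, t = 1 / (2 * (32 * Dd * κ * A * cg) + 1) := ⟨_, rfl⟩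
  obtain ⟨w₂, hw₂def⟩ : ∃ t : ℝ, t = 1 / (2 * (Fs * KT * L ^ 4 * c₃ * c₄) + 1) := ⟨_, rfl⟩
  have hw₁0 : 0 < w₁ := by rw [hw₁def]; positivity
  have hw₂0 : 0 < w₂ := by rw [hw₂def]; positivity
  obtain ⟨a₀K, ha₀Kdef⟩ : ∃ t : ℝ, t = min (alphaQ (θ.d₆ + 1) (θ.ℓ₆ + 1)) (min w₁ w₂) := ⟨_, rfl⟩
  have ha₀K : 0 < a₀K := by rw [ha₀Kdef]; exact lt_min (alphaQ_pos _ (Nat.le_add_left 1 θ.ℓ₆)) (lt_min hw₁0 hw₂0)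
  have haQ : a₀K ≤ alphaQ (θ.d₆ + 1) (θ.ℓ₆ + 1) := by rw [ha₀Kdef]; exact min_le_left _ _
  have haw₁ : a₀K ≤ 1 / (2 * (32 * Dd * κ * A * cg) + 1) := by rw [ha₀Kdef, ← hw₁def]; exact (min_le_right _ _).trans (min_le_left _ _)
  have haw₂ : a₀K ≤ 1 / (2 * (Fs * KT * L ^ 4 * c₃ * c₄) + 1) := by rw [ha₀Kdef, ← hw₂def]; exact (min_le_right _ _).trans (min_le_right _ _)
  have hα3 : B7Prop2Explicit.C0 (θ.d₆ + 1) * a₀K ≤ 1 / 3 :=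
    (mul_le_mul_of_nonneg_left haQ (B7Prop2Explicit.C0_pos _).le).trans (C0_mul_alphaQ_le _ _)
  have hα2 : 2 * a₀K ≤ B7Prop2Explicit.c2' (θ.d₆ + 1) (θ.ℓ₆ + 1) := by linarith only [four_mul_alphaQ_le (θ.d₆ + 1) (θ.ℓ₆ + 1), haQ, ha₀K]
  -- ═══ the junction's own constants at `α₀′ := a₀K` (opaque atoms with defining equations, in file 5's binder shapes) ═══
  obtain ⟨θE, hθEdef⟩ : ∃ t : ℝ, t = 32 * Dd * a₀K * κ := ⟨_, rfl⟩
  have hθE0 : 0 ≤ θE := by rw [hθEdef]; positivity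
  have hW1 : θE * A * cg ≤ 1 / 2 := by
    have h := le_half_of_le_window (x := 32 * Dd * κ * A * cg) (by positivity) ha₀K.le haw₁
    calc θE * A * cg = a₀K * (32 * Dd * κ * A * cg) := by rw [hθEdef]; ring
      _ ≤ 1 / 2 := h
  have hWnn : 0 ≤ θE * A * cg := by positivity
  obtain ⟨hsmallg, hAKle, -⟩ := window_AK_BX (A₁ := A) hWnn hW1 hA0 hA0 hcg0
  obtain ⟨AK, hAKdef⟩ : ∃ t : ℝ, t = A * cg * (1 - θE * A * cg)⁻¹ := ⟨_, rfl⟩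
  have hAK0 : 0 ≤ AK := by rw [hAKdef]; exact mul_nonneg (mul_nonneg hA0 hcg0) (inv_nonneg.2 (by linarith only [hsmallg]))
  have hAKs : AK ≤ AKs := by rw [hAKdef, hAKsdef]; exact hAKle
  obtain ⟨θF, hθFdef⟩ : ∃ t : ℝ, t = (2 * (8 * Dd * a₀K) * κ) * κ * (A * A * L ^ 2 * c₁)
      + κ * κ * ((A + AK) * (AK * (θE * A) * L ^ 2 * c₁) * L ^ 2 * c₂) + κ * ((2 * (8 * Dd * a₀K)) * κ) * (AK * AK * L ^ 2 * c₁) := ⟨_, rfl⟩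
  have hθF0 : 0 ≤ θF := by rw [hθFdef]; positivity
  have hθFle : θF ≤ a₀K * Fs := by
    have h := thetaF_le (C := L ^ 2) (c₁ := c₁) (c₂ := c₂) (D := Dd) (κ := κ) (A := A) ha₀K.le hκ0 hA0 hAK0 hAKs (by positivity) hc₁0 hc₂0 hDd0
    rw [hθFdef, hFsdef, hθEdef]
    calc _ = (2 * (8 * Dd * a₀K) * κ) * κ * (A * A * L ^ 2 * c₁) + κ * κ * ((A + AK) * (AK * ((32 * Dd * a₀K * κ) * A) * L ^ 2 * c₁) * L ^ 2 * c₂)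
          + κ * (2 * (8 * Dd * a₀K) * κ) * (AK * AK * L ^ 2 * c₁) := by ring
      _ ≤ _ := h
      _ = _ := by ring
  have hW2 : θF * KT * L ^ 4 * c₃ * c₄ ≤ 1 / 2 := by
    have h2 : a₀K * (Fs * KT * L ^ 4 * c₃ * c₄) ≤ 1 / 2 := le_half_of_le_window (by positivity) ha₀K.le haw₂
    have h3 : θF * KT * L ^ 4 * c₃ * c₄ ≤ a₀K * Fs * KT * L ^ 4 * c₃ * c₄ :=
      mul_le_mul_of_nonneg_right (mul_le_mul_of_nonneg_right (mul_le_mul_of_nonneg_right (mul_le_mul_of_nonneg_right hθFle hKT) (by positivity)) hc₃0) hc₄0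
    calc θF * KT * L ^ 4 * c₃ * c₄ ≤ a₀K * Fs * KT * L ^ 4 * c₃ * c₄ := h3
      _ = a₀K * (Fs * KT * L ^ 4 * c₃ * c₄) := by ring
      _ ≤ 1 / 2 := h2
  obtain ⟨hsmall2, hKKle, -⟩ := window_KK_B1 (K := KT) (c₄ := c₄) hW2 hKT hc₄0
  obtain ⟨KK, hKKdef⟩ : ∃ t : ℝ, t = KT * c₄ * (1 - θF * KT * L ^ 4 * c₃ * c₄)⁻¹ := ⟨_, rfl⟩
  have hKKle' : KK ≤ 2 * KT * c₄ := by rw [hKKdef]; exact hKKle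
  -- ═══ the thresholds ═══
  have hD1 : 0 ≤ D1 thetaProf := D1_nonneg contDiff_thetaProf hasCompactSupport_thetaProf
  obtain ⟨amin, hamin⟩ : ∃ t : ℝ, t = min (min a₁G a₁T) (1 / 4) := ⟨_, rfl⟩
  have hamin0 : 0 < amin := by rw [hamin]; exact lt_min (lt_min ha₁G ha₁T) (by norm_num)
  have haminG : amin ≤ a₁G := by rw [hamin]; exact (min_le_left _ _).trans (min_le_left _ _)
  have haminT : amin ≤ a₁T := by rw [hamin]; exact (min_le_left _ _).trans (min_le_right _ _)
  have hamin4 : amin ≤ 1 / 4 := by rw [hamin]; exact min_le_right _ _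
  have he4 : 0 < Real.exp 4 := Real.exp_pos _
  obtain ⟨abud, habud⟩ : ∃ t : ℝ, t = min (amin / (2 * L ^ 6 * (1 + D1 thetaProf))) (min (1 / (10 * L)) (a₀K / (2 * (40 * Real.exp 4 * L ^ 5)))) :=
    ⟨_, rfl⟩
  have habud0 : 0 < abud := by
    rw [habud]
    exact lt_min (div_pos hamin0 (by positivity)) (lt_min (by positivity) (div_pos ha₀K (by positivity)))
  obtain ⟨Mtr, hMtr⟩ : ∃ t : ℝ, t = 16 * Real.log L / (1 / 4 * ρ * (2 * L ^ 2 - 1)) := ⟨_, rfl⟩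
  obtain ⟨M₁, hM₁def⟩ : ∃ t : ℝ, t = max (max 1 Mtr) (max (max (max M₀G M₀T) (max ((N₀G : ℝ) + 1) ((N₀T : ℝ) + 1)))
    (max (max (T₀G + 1) (T₀T + 1)) (max MLA MLB))) := ⟨_, rfl⟩
  -- output constants (member-free)
  obtain ⟨δo, hδodef⟩ : ∃ t : ℝ, t = (1 - 1 / 4) * δ₃ := ⟨_, rfl⟩
  obtain ⟨B₀, hB₀def⟩ : ∃ t : ℝ, t = 2 * KT * c₄ + 1 := ⟨_, rfl⟩
  have hc35 : (0 : ℝ) < c35Y := by norm_num [c35Y]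
  refine ⟨M₁, c35Y * abud, B₀, δo, by rw [hM₁def]; exact lt_of_lt_of_le one_pos ((le_max_left _ _).trans (le_max_left _ _)), by positivity,
    by rw [hB₀def]; positivity, by rw [hδodef]; positivity, ?_⟩
  intro bI hβI x hsurj hM α₀ hα ha' U hU
  rw [hM₁def] at hM
  have ha : (geo9Y x).M * α₀ ≤ abud := by
    have h1 : c35Y * ((geo9Y x).M * α₀) ≤ c35Y * abud := by rw [← mul_assoc]; exact ha'
    exact le_of_mul_le_mul_left h1 hc35
  rw [habud] at ha
  -- ═══ the member's index facts ═══
  have hMeq : (geo9Y x).M = L * x.Mh := by rw [B9Ineq349SiteFromBlocks.geo9Y_M_eq]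
  have hMK' : (kGeo x.toKIdx).M = (geo9Y x).M := rfl
  have hMK9 : (geo9K x.toKIdx).M = (geo9Y x).M := rfl
  have hLK : (kGeo x.toKIdx).L = L := by rw [hLdef]; show (((θ.ℓ₆ + 1 : ℕ) : ℝ)) = _; push_cast; ring
  have hMmid : max (max M₀G M₀T) (max ((N₀G : ℝ) + 1) ((N₀T : ℝ) + 1)) ≤ (geo9Y x).M := ((le_max_left _ _).trans (le_max_right _ _)).trans hM
  have hMlast : max (max (T₀G + 1) (T₀T + 1)) (max MLA MLB) ≤ (geo9Y x).M := ((le_max_right _ _).trans (le_max_right _ _)).trans hM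
  have hMpos : 0 ≤ (geo9Y x).M := geo9Y_M_nonneg θ Mstar x
  have hMh1 : 1 ≤ (θ.ℓ₆ + 1) * x.Mh := Nat.one_le_iff_ne_zero.2 (Nat.mul_ne_zero (Nat.succ_ne_zero _) (by have := x.hM8; omega))
  have hR1 : 1 ≤ x.R := le_trans (by have := θ.one_le_ℓ₆; nlinarith) x.hR2
  have idxM : ∀ {M₀ : ℝ}, M₀ ≤ (geo9Y x).M → M₀ ≤ ((θ.ℓ₆ : ℝ) + 1) * (toKT x.toKIdx).Mh := fun h => by rw [hMeq] at h; exact h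
  have idxN : ∀ {N₀ : ℕ}, ((N₀ : ℝ) + 1) ≤ (geo9Y x).M → N₀ + 1 ≤ (toKT x.toKIdx).R * ((θ.ℓ₆ + 1) * (toKT x.toKIdx).Mh) := by
    intro N₀ h
    show N₀ + 1 ≤ x.R * ((θ.ℓ₆ + 1) * x.Mh)
    have h1 : ((N₀ : ℝ) + 1) ≤ L * x.Mh := by rw [← hMeq]; exact h
    have h2 : N₀ + 1 ≤ (θ.ℓ₆ + 1) * x.Mh := by rw [hLdef] at h1; exact_mod_cast h1
    exact h2.trans (Nat.le_mul_of_pos_left _ hR1)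
  have idxT : ∀ {T₀ : ℝ}, T₀ + 1 ≤ (geo9Y x).M → T₀ ≤ B9CubeGeometryInputs.RM1 x.toKIdx := by
    intro T₀ h
    unfold B9CubeGeometryInputs.RM1
    show T₀ ≤ (((x.R * ((θ.ℓ₆ + 1) * x.Mh) - 1 : ℕ)) : ℝ)
    have h1 : T₀ + 1 ≤ L * x.Mh := by rw [← hMeq]; exact h
    have h3 : (θ.ℓ₆ + 1) * x.Mh ≤ x.R * ((θ.ℓ₆ + 1) * x.Mh) := Nat.le_mul_of_pos_left _ hR1
    have h4 : (((θ.ℓ₆ + 1) * x.Mh : ℕ) : ℝ) ≤ ((x.R * ((θ.ℓ₆ + 1) * x.Mh) : ℕ) : ℝ) := by exact_mod_cast h3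
    rw [Nat.cast_sub (hMh1.trans h3)]
    push_cast at h4 ⊢
    rw [hLdef] at h1
    linarith only [h1, h4]
  have hM0G := idxM ((le_max_left _ _).trans ((le_max_left _ _).trans hMmid))
  have hM0T := idxM ((le_max_right _ _).trans ((le_max_left _ _).trans hMmid))
  have hN0G := idxN ((le_max_left _ _).trans ((le_max_right _ _).trans hMmid))
  have hN0T := idxN ((le_max_right _ _).trans ((le_max_right _ _).trans hMmid))
  have hT0G := idxT ((le_max_left _ _).trans ((le_max_left _ _).trans hMlast))
  have hT0T := idxT ((le_max_right _ _).trans ((le_max_left _ _).trans hMlast))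
  have hMLA : MLA ≤ (geo9K x.toKIdx).M := (le_max_left _ _).trans ((le_max_right _ _).trans hMlast)
  have hMLB : MLB ≤ (geo9K x.toKIdx).M := (le_max_right _ _).trans ((le_max_right _ _).trans hMlast)
  have hMtr' : Mtr ≤ (geo9Y x).M := (le_max_right _ _).trans ((le_max_left _ _).trans hM)
  -- ═══ the guard `M·α₀ ≤ a₁` unfolded ═══
  have hMα : 0 ≤ (geo9Y x).M * α₀ := mul_nonneg hMpos hα.le
  have ha1 : (geo9Y x).M * α₀ ≤ amin / (2 * L ^ 6 * (1 + D1 thetaProf)) := ha.trans (min_le_left _ _)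
  have ha3 : (geo9Y x).M * α₀ ≤ 1 / (10 * L) := ha.trans ((min_le_right _ _).trans (min_le_left _ _))
  have ha4 : (geo9Y x).M * α₀ ≤ a₀K / (2 * (40 * Real.exp 4 * L ^ 5)) := ha.trans ((min_le_right _ _).trans (min_le_right _ _))
  have hK1 : 10 * (kGeo x.toKIdx).L * ((kGeo x.toKIdx).M * α₀) ≤ 1 := by
    rw [hLK, hMK']
    have := (le_div_iff₀ (by positivity : (0:ℝ) < 10 * L)).1 ha3
    linarith only [this]
  have hKnum : Kpl x.toKIdx ((kGeo x.toKIdx).M * α₀) * (kGeo x.toKIdx).L ^ 4 < a₀K := by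
    refine Kpl_lt_of_le x.toKIdx (by rw [hMK']; exact hMα) hK1 ?_
    rw [hLK, hMK']
    have hpos : (0:ℝ) < 2 * (40 * Real.exp 4 * L ^ 5) := by positivity
    have h1 := (le_div_iff₀ hpos).1 ha4
    linarith only [h1, ha₀K]
  -- ═══ the class: `U` is `SU(N)`-valued; the cube datum on the balls `NearC_□(35S_j∕8 + 1)` ═══
  have hUG : ∀ μ z, U μ z ∈ specialUnitaryUnits (Fin N) := hU.1.1
  obtain ⟨hη, hLK1, hMK⟩ := eta_pos_L_one_le_M_pos x.toKIdx
  have hdat : ∀ c : ↥(cubes (toKT x.toKIdx).D.toDomains),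
      Reg335Cube (shiftsV1 (PV θ.d₆ θ.ℓ₆ x.m x.K θ.hd' θ.hL')) U (kGeo x.toKIdx).eta
        {w | NearC x.toKIdx c (35 * SC x.toKIdx c / 8 + 1) (boxEquiv x.hN w).1}
        (scaleLen (kGeo x.toKIdx).L (kGeo x.toKIdx).eta c.1.1) (2 * (kGeo x.toKIdx).L ^ 4 * ((kGeo x.toKIdx).M * α₀)) :=
    fun c => reg335Cube_nearC_of_reg335P x.toKIdx c (by norm_num [c35Y]) hα.le hU.1
  obtain ⟨g, Afld, hu, hgA, hA, hdA⟩ := exists_cubeData_of_reg335Cubes x.toKIdx U _ _ _ hdat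
  have hC0 : 0 ≤ 2 * (kGeo x.toKIdx).L ^ 4 * ((kGeo x.toKIdx).M * α₀) := by rw [hMK']; positivity
  have hξ0 : ∀ c : ↥(cubes (toKT x.toKIdx).D.toDomains), 0 < scaleLen (kGeo x.toKIdx).L (kGeo x.toKIdx).eta c.1.1 :=
    fun c => LatticeNorms.scaleLen_pos (lt_of_lt_of_le one_pos hLK1) hη _
  have hξ5 : ∀ c : ↥(cubes (toKT x.toKIdx).D.toDomains),
      scaleLen (kGeo x.toKIdx).L (kGeo x.toKIdx).eta c.1.1 ≤ 5 * (SC x.toKIdx c : ℝ) * (kGeo x.toKIdx).eta := by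
    intro c
    unfold LatticeNorms.scaleLen
    have hS : (kGeo x.toKIdx).L ^ c.1.1 ≤ (SC x.toKIdx c : ℝ) := by
      rw [hLK, hLdef]
      show ((θ.ℓ₆ : ℝ) + 1) ^ c.1.1 ≤ ((B9CubeSequence408.sI θ.ℓ₆ (toKT x.toKIdx).Mh c.1.1 : ℤ) : ℝ)
      unfold B9CubeSequence408.sI B6MultiLevelBoxOperator.bigSide
      have h8 : 8 ≤ x.Mh := x.hM8
      have h1 : (θ.ℓ₆ + 1) ^ c.1.1 ≤ x.Mh * (θ.ℓ₆ + 1) ^ (c.1.1 + 1) :=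
        le_trans (Nat.pow_le_pow_right (Nat.succ_pos _) (Nat.le_succ _)) (Nat.le_mul_of_pos_left _ (by omega))
      have h2 : (((θ.ℓ₆ + 1) ^ c.1.1 : ℕ) : ℝ) ≤ ((x.Mh * (θ.ℓ₆ + 1) ^ (c.1.1 + 1) : ℕ) : ℝ) := by exact_mod_cast h1
      push_cast at h2 ⊢
      exact h2
    have hSC0 : 0 ≤ (SC x.toKIdx c : ℝ) := le_trans (pow_pos (lt_of_lt_of_le one_pos hLK1) _).le hS
    have hSe : 0 ≤ (SC x.toKIdx c : ℝ) * (kGeo x.toKIdx).eta := mul_nonneg hSC0 hη.le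
    calc (kGeo x.toKIdx).L ^ c.1.1 * (kGeo x.toKIdx).eta ≤ (SC x.toKIdx c : ℝ) * (kGeo x.toKIdx).eta :=
          mul_le_mul_of_nonneg_right hS hη.le
      _ ≤ 5 * (SC x.toKIdx c : ℝ) * (kGeo x.toKIdx).eta := by linarith only [hSe]
  have hscale : ∀ c : ↥(cubes (toKT x.toKIdx).D.toDomains),
      scaleLen ((θ.ℓ₆ : ℝ) + 1) (kGeo x.toKIdx).eta (c.1.1 + 1) ≤ (kGeo x.toKIdx).L * scaleLen (kGeo x.toKIdx).L (kGeo x.toKIdx).eta c.1.1 := by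
    intro c; rw [hLK, hLdef, B9Eq335ClassBridgePV1.scaleLen_succ']
  have hsmallC : 2 * L ^ 6 * (1 + D1 thetaProf) * ((geo9Y x).M * α₀) ≤ amin := by
    have hpos : 0 < 2 * L ^ 6 * (1 + D1 thetaProf) := by positivity
    calc 2 * L ^ 6 * (1 + D1 thetaProf) * ((geo9Y x).M * α₀)
        ≤ 2 * L ^ 6 * (1 + D1 thetaProf) * (amin / (2 * L ^ 6 * (1 + D1 thetaProf))) := mul_le_mul_of_nonneg_left ha1 hpos.le
      _ = amin := mul_div_cancel₀ _ hpos.ne'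
  have hmaxeq : max (2 * (kGeo x.toKIdx).L ^ 4 * ((kGeo x.toKIdx).M * α₀)) (2 * (kGeo x.toKIdx).L ^ 4 * ((kGeo x.toKIdx).M * α₀) * (1 + D1 thetaProf))
      * (kGeo x.toKIdx).L ^ 2 = 2 * L ^ 6 * (1 + D1 thetaProf) * ((geo9Y x).M * α₀) := by
    rw [max_eq_right (le_mul_of_one_le_right hC0 (by linarith only [hD1])), hLK, hMK']; ring
  have hbudG : ∀ _c : ↥(cubes (toKT x.toKIdx).D.toDomains),
      max (2 * (kGeo x.toKIdx).L ^ 4 * ((kGeo x.toKIdx).M * α₀)) (2 * (kGeo x.toKIdx).L ^ 4 * ((kGeo x.toKIdx).M * α₀) * (1 + D1 thetaProf))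
        * (kGeo x.toKIdx).L ^ 2 ≤ a₁G := fun _ => by
    rw [hmaxeq]; exact hsmallC.trans haminG
  have hbudT : ∀ _c : ↥(cubes (toKT x.toKIdx).D.toDomains),
      max (2 * (kGeo x.toKIdx).L ^ 4 * ((kGeo x.toKIdx).M * α₀)) (2 * (kGeo x.toKIdx).L ^ 4 * ((kGeo x.toKIdx).M * α₀) * (1 + D1 thetaProf))
        * (kGeo x.toKIdx).L ^ 2 ≤ a₁T := fun _ => by
    rw [hmaxeq]; exact hsmallC.trans haminT
  have hbud4 : ∀ _c : ↥(cubes (toKT x.toKIdx).D.toDomains),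
      max (2 * (kGeo x.toKIdx).L ^ 4 * ((kGeo x.toKIdx).M * α₀)) (2 * (kGeo x.toKIdx).L ^ 4 * ((kGeo x.toKIdx).M * α₀) * (1 + D1 thetaProf))
        * (kGeo x.toKIdx).L ^ 2 ≤ 1 / 4 := fun _ => by
    rw [hmaxeq]; exact hsmallC.trans hamin4
  -- ═══ the geometry at the member ═══
  obtain ⟨htri, hrefl, -, -, -, h261d, h261g, h263g⟩ := hgeoA x.toKIdx hMLA
  obtain ⟨-, -, -, -, h261d₁, h261d₂, h261d₃, h263d₃⟩ := hgeoB x.toKIdx hMLB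
  -- the transfers (one threshold `Mtr` serves all: rates `≥ ρ`, powers `≤ 4`)
  have hthr : 16 * Real.log L ≤ 1 / 4 * ρ * (2 * L ^ 2 - 1) * (geo9K x.toKIdx).M := by
    have hpos : 0 < 1 / 4 * ρ * (2 * L ^ 2 - 1) := mul_pos (mul_pos (by norm_num) hρ) hPL'
    rw [hMtr] at hMtr'
    have := (div_le_iff₀ hpos).1 hMtr'
    rw [hMK9]; linarith only [this]
  have hMge : 0 ≤ (geo9K x.toKIdx).M := by rw [hMK9]; exact hMpos
  have hρδ₂ : ρ ≤ δ₂ := by rw [hρdef, hδcdef, hδ₃def]; linarith only [hδ₂]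
  have hρδ₁ : ρ ≤ δ₁ := by rw [hδ₂def] at hρδ₂; linarith only [hρδ₂, hδ₁]
  have hρδ' : ρ ≤ δ := by rw [hδ₁def] at hρδ₁; linarith only [hρδ₁, hδ]
  have hST : ScaleTransfer (geo9K x.toKIdx) δ (1 / 4) (L ^ 2) (fun a => (geo9K x.toKIdx).len a ^ 2) := by
    have h := scaleTransfer_len_sq_geo9K x.toKIdx (δ := δ) (α := 1 / 4) (by positivity)
      (log_le_rate_mul hlogL hPL hMge hρδ' (by norm_num) hthr)
    rw [← hLdef] at h; exact h
  have hST₂ : ScaleTransfer (geo9K x.toKIdx) δ₁ (1 / 4) (L ^ 2) (fun a => (geo9K x.toKIdx).len a ^ 2) := by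
    have h := scaleTransfer_len_sq_geo9K x.toKIdx (δ := δ₁) (α := 1 / 4) (by positivity)
      (log_le_rate_mul hlogL hPL hMge hρδ₁ (by norm_num) hthr)
    rw [← hLdef] at h; exact h
  have hST₃ : ScaleTransfer (geo9K x.toKIdx) δ₂ (1 / 4) (L ^ 4) (fun a => ((geo9K x.toKIdx).len a ^ 4)⁻¹) := by
    have h := scaleTransfer_len_inv_pow_geo9K x.toKIdx 4 (δ := δ₂) (α := 1 / 4) (by positivity)
      (by exact log_le_rate_mul hlogL hPL hMge hρδ₂ (by norm_num) hthr)
    rw [← hLdef] at h; exact h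
  -- ═══ the junction's defining equations in file 5's literal shapes (atoms unfolded to `B6.c1 …` once, by `rw`) ═══
  have hθE' : θE = 32 * ((θ.d₆ : ℝ) + 1) ^ 2 * a₀K * (M₂ * ∑ j, ‖basis39 (Matrix (Fin N) (Fin N) ℂ) j‖) := by
    rw [hθEdef]
  have hAK' := hAKdef
  rw [hcgdef] at hAK'
  have hsmallg' : θE * A * B6.c1 (max (exp261 (geo9K (d := θ.d₆) (ℓ := θ.ℓ₆) (hd := θ.hd') (hL := θ.hL') (b₀ := θ.b₀) (b₁ := θ.b₁)) ((1 - 1 / 4) * δ) (1 / 4))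
      (exp261 (geo9K (d := θ.d₆) (ℓ := θ.ℓ₆) (hd := θ.hd') (hL := θ.hL') (b₀ := θ.b₀) (b₁ := θ.b₁)) δ₀ (1 / 2))) δ₀ (1 / 2) < 1 := by
    rw [← hcgdef]; exact hsmallg
  have hθF' := hθFdef
  rw [hc₁def, hc₂def] at hθF'
  have hsmall2' := hsmall2
  rw [hc₃def, hc₄def] at hsmall2'
  -- ═══ the section through the faithful representative (β onto) ═══
  have hι : ∀ s : BlkY x.toKIdx, β x.hN x.D x.hk (rep39F x.toKIdx (bI x) s) = s := by
    intro s
    obtain ⟨c, rfl⟩ := hsurj s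
    exact beta_rep39F_beta (hβI x) c
  -- ═══ def-Y's-side data: Thm 3.1 for `G′(U; parSymY)` from the cube datum, read as the site entry; Thm 3.2 for `X(U; parSymY)⁻¹` ═══
  have hEG := (HG x.toKIdx hM0G hN0G hT0G x.hcfk (rep39F x.toKIdx (bI x)) hι U hUG g hu Afld _ _ _ _ (fun _ => hC0) hξ0 (fun _ => hLK1) hξ5 hscale
    (fun c w hw => hw) hgA hA hdA hbudG hbud4 (B := bg9YP (Matrix (Fin N) (Fin N) ℂ) (specialUnitaryUnits (Fin N)) x) (fun V => V) U rfl).1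
  obtain ⟨hGs, -, -⟩ := symData_of_eBlockS x.toKIdx x.hcfk (Rg := 0) (Hg := True) (basis39 (Matrix (Fin N) (Fin N) ℂ)) hM₂ hrepr hKG
    (B := bg9YP (Matrix (Fin N) (Fin N) ℂ) (specialUnitaryUnits (Fin N)) x) (fun V => V) U U rfl hEG (rep39F x.toKIdx (bI x)) hι
  have hT₀ := HT x.toKIdx hM0T hN0T hT0T x.hcfk (rep39F x.toKIdx (bI x)) hι U hUG g hu Afld _ _ _ _ (fun _ => hC0) hξ0 (fun _ => hLK1) hξ5 hscale
    (fun c w hw => hw) hgA hA hdA hbudT hbud4 (B := bg9YP (Matrix (Fin N) (Fin N) ℂ) (specialUnitaryUnits (Fin N)) x) (fun V => V) U rfl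
  -- weaken both to the base rate `δ₀`
  have hl2 : ∀ a : (geo9K x.toKIdx).Site, 0 ≤ (geo9K x.toKIdx).len a ^ 2 := fun a => sq_nonneg _
  have hl1 : ∀ a : (geo9K x.toKIdx).Site, 0 ≤ (geo9K x.toKIdx).len a := fun a => (geo9K_len_pos x.toKIdx a).le
  have hl4 : ∀ a : (geo9K x.toKIdx).Site, 0 ≤ ((geo9K x.toKIdx).len a ^ 4)⁻¹ := fun a => inv_nonneg.2 (pow_nonneg (hl1 a) 4)
  have hGs' := hasMajorant_rate_mono x.toKIdx (Rr := 0) (Hp := True) _ (fun a => (geo9K x.toKIdx).len a ^ 2) hA0 hl2 hδ₀G hGs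
  have hT₀' := hasMajorant_rate_mono x.toKIdx (Rr := 0) (Hp := True) _ (fun a => ((geo9K x.toKIdx).len a ^ 4)⁻¹) hKT hl4 hδ₀T hT₀
  -- ═══ file 5: (3.48) at the knit letter on (3.35) at `α₀′ := a₀K`, every constant passed as an atom ═══
  have hC := hasMajorant_conj_XinvY_parKnitY_of_data_reg335 x.toKIdx (basis39 (Matrix (Fin N) (Fin N) ℂ)) (rep39F x.toKIdx (bI x)) (Rr := 0) (Hp := True)
    hG1 hGU (by norm_num [c35Y]) (by rw [hMK']; exact hMα) hU.1 ha₀K hα3 hα2 hKnum hι x.hcfk hM₂ hrepr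
    _ hA0 hKT (hαδg := by positivity) (hαδg' := by positivity) htri hrefl h261g h263g (hθE := hθE') (hAK := hAK') hsmallg' hGs' hT₀'
    _ _ _ _ (δ := δ) (δ₁ := δ₁) (δ₂ := δ₂) (δ₃ := δ₃) (αst := 1 / 4) (α' := 1 / 4) (α := 1 / 4) (C := L ^ 2) (C₄ := L ^ 4)
    (by rw [hδdef]; linarith only [hδ₀]) rfl rfl rfl (by positivity) (one_le_pow₀ hL1) (by positivity)
    (by positivity) (by norm_num) (by norm_num) (by positivity) (by positivity) (by positivity) (by positivity) (by positivity) (by positivity)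
    hST h261d hST₂ h261d₁ hST₃ h261d₂ h261d₃ h263d₃ (hθF := hθF') hsmall2'
  rw [← hc₃def, ← hc₄def, ← hKKdef] at hC
  -- ═══ read back through the rows-15∕16 dictionary ═══
  set T : Module.End ℝ (X39 (Matrix (Fin N) (Fin N) ℂ) x.toKIdx → ℝ) :=
    realify39 (basis39 (Matrix (Fin N) (Fin N) ℂ))
      ((((unit39 x.toKIdx)⁻¹ : ℝ) : ℂ) • XinvY x.toKIdx (parKnitY x.toKIdx) (GpY x.toKIdx (parKnitY x.toKIdx)) U) with hTdef
  have hTeq : T = conj (basis39 (Matrix (Fin N) (Fin N) ℂ))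
      ((etaS x.toKIdx ^ 2 * etaS x.toKIdx ^ 2)⁻¹ • (XinvY x.toKIdx (parKnitY x.toKIdx) (GpY x.toKIdx (parKnitY x.toKIdx)) U).restrictScalars ℝ) := by
    rw [hTdef, realify39_real_smul_eq_conj, unit39_eq_etaS_sq_mul]
  rw [← hTeq] at hC
  have hmaj' : HasMajorant (g := b6 (geo9Y x)) (blk39F (Matrix (Fin N) (Fin N) ℂ) x.toKIdx (bI x)) T
      (fun a a' => KK * ((geo9K x.toKIdx).len a ^ 4)⁻¹ * Real.exp (-((1 - 1 / 4) * δ₃ * (geo9K x.toKIdx).dist a a'))) := by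
    intro y' μ B hμ p
    exact hC y' μ B ⟨hμ.nonneg, hμ.bound, hμ.off⟩ p
  have hinv := invL39_parKnitY_two_sided_of_reg335P x.toKIdx (by norm_num [c35Y]) (by rw [hMK']; exact hMα) hU.1 ha₀K hα3 hα2 hKnum
  refine ⟨T, hinv.1, hinv.2, hasMajorant_mono _ hmaj' fun a a' => ?_⟩
  have hlen : 0 < (geo9Y x).len a := geo9Y_len_pos x a
  have hl4eq : ((geo9K x.toKIdx).len a ^ 4)⁻¹ = (geo9Y x).len a ^ (-(4 : ℝ)) := by
    rw [Real.rpow_neg hlen.le, show ((4 : ℝ)) = ((4 : ℕ) : ℝ) by norm_num, Real.rpow_natCast]; rfl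
  have hKB : KK ≤ B₀ := by rw [hB₀def]; linarith only [hKKle']
  rw [hl4eq, hδodef]
  exact mul_le_mul_of_nonneg_right (mul_le_mul_of_nonneg_right hKB (Real.rpow_nonneg hlen.le _)) (Real.exp_nonneg _)

/-! ## §2 The R-generic premise (the certificate's `h348` binder shape), the carrier `SCMemberY`, a letters family with the `G′`-pin -/

/-- ★★★ **ROWS 15–16's DISPLAY AT THE KNIT LETTER, AT THE N06 KNIT CERTIFICATE's R-GENERIC PREMISE** («KA»∕«KB»'s binder `h348` with `(𝔏 x).Gp = GpY x (parKnitY x)`,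
premised on `(bg9YR … R₁ R₂ x).Reg335 c α₀ U` with the certificate's displayed class transfer `hRP1`, its guard `c·M·α₀ ≦ a₁` and `0 < c`): for every
regularity pair `(R₁, R₂)` whose first family lands in print's class (3.35), there are `M₁, a₁, B₀, δ₀ > 0` with
`Conv348Blk (oneCubeOps39 (geo9Y x) (bg9YR … R₁ R₂ x) (blk39F … (bI x)) (L39 x.toKIdx (parKnitY x.toKIdx) (GpY x.toKIdx (parKnitY x.toKIdx)))) B₀ δ₀ U` for every
SECTION-CARRYING member above `M₁`, every `α₀ > 0` with `c·M·α₀ ≦ a₁` and every `U` of the R-class.  (At inner-corner members the display stays displayed.)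
[cite: Balaban1985BackgroundPropagators, Thm 3.2 (3.48) p.398 + (3.96) p.411 + (3.19) p.393 + (3.35) p.396; Balaban1984PropagatorsII, (2.51) p.232 + (2.86) p.238] -/
theorem conv348_oneCube_parKnitY_of_regYR_section (hN : 1 ≤ N)
    {R₁ R₂ : RegFamY θ.d₆ θ.ℓ₆ θ.hd' θ.hL' θ.b₀ θ.b₁ Mstar (Matrix (Fin N) (Fin N) ℂ)} {c : ℝ} (hc : 0 < c)
    (hRP1 : ∀ (x : MemberY θ.d₆ θ.ℓ₆ θ.hd' θ.hL' θ.b₀ θ.b₁ Mstar) (α₀ : ℝ)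
      (U : (bg9YR (Matrix (Fin N) (Fin N) ℂ) (specialUnitaryUnits (Fin N)) R₁ R₂ x).Cfg),
      (bg9YR (Matrix (Fin N) (Fin N) ℂ) (specialUnitaryUnits (Fin N)) R₁ R₂ x).Reg335 c α₀ U →
        0 ≤ α₀ ∧ (bg9YP (Matrix (Fin N) (Fin N) ℂ) (specialUnitaryUnits (Fin N)) x).Reg335 c35Y α₀ U) :
    ∃ M₁ a₁ B₀ δ₀ : ℝ, 0 < M₁ ∧ 0 < a₁ ∧ 0 < B₀ ∧ 0 < δ₀ ∧
    ∀ (bI : ∀ x : MemberY θ.d₆ θ.ℓ₆ θ.hd' θ.hL' θ.b₀ θ.b₁ Mstar, FBondY x.toKIdx → IBondY x.toKIdx)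
      (_hβI : ∀ (x : MemberY θ.d₆ θ.ℓ₆ θ.hd' θ.hL' θ.b₀ θ.b₁ Mstar) (f : FBondY x.toKIdx) (c : IBondY x.toKIdx),
        blkV1 x.hN x.D f = β x.hN x.D x.hk c → β x.hN x.D x.hk (bI x f) = blkV1 x.hN x.D f)
      (x : MemberY θ.d₆ θ.ℓ₆ θ.hd' θ.hL' θ.b₀ θ.b₁ Mstar), Function.Surjective (β x.hN x.D x.hk) → M₁ ≤ (geo9Y x).M →
      ∀ α₀ : ℝ, 0 < α₀ → c * (geo9Y x).M * α₀ ≤ a₁ →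
      ∀ U : (bg9YR (Matrix (Fin N) (Fin N) ℂ) (specialUnitaryUnits (Fin N)) R₁ R₂ x).Cfg,
        (bg9YR (Matrix (Fin N) (Fin N) ℂ) (specialUnitaryUnits (Fin N)) R₁ R₂ x).Reg335 c α₀ U →
        Conv348Blk (oneCubeOps39 (geo9Y x) (bg9YR (Matrix (Fin N) (Fin N) ℂ) (specialUnitaryUnits (Fin N)) R₁ R₂ x)
          (blk39F (Matrix (Fin N) (Fin N) ℂ) x.toKIdx (bI x)) (L39 x.toKIdx (parKnitY x.toKIdx) (GpY x.toKIdx (parKnitY x.toKIdx)))) B₀ δ₀ U := by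
  obtain ⟨M₁, a₁, B₀, δ₀, hM₁, ha₁, hB₀, hδ₀, h⟩ := conv348_oneCube_parKnitY_of_regYP335_section (N := N) θ Mstar hN
  have hc35 : (0 : ℝ) < c35Y := by norm_num [c35Y]
  refine ⟨M₁, a₁ * (c / c35Y), B₀, δ₀, hM₁, by positivity, hB₀, hδ₀, fun bI hβI x hsurj hM α₀ hα ha U hU => ?_⟩
  refine h bI hβI x hsurj hM α₀ hα ?_ U (hRP1 x α₀ U hU).2
  have h1 : c * ((geo9Y x).M * α₀) ≤ a₁ * (c / c35Y) := by rw [← mul_assoc]; exact ha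
  have h2 : c35Y * ((geo9Y x).M * α₀) * c ≤ a₁ * c := by
    have := mul_le_mul_of_nonneg_left h1 hc35.le
    calc c35Y * ((geo9Y x).M * α₀) * c = c35Y * (c * ((geo9Y x).M * α₀)) := by ring
      _ ≤ c35Y * (a₁ * (c / c35Y)) := this
      _ = a₁ * c := by field_simp
  rw [← mul_assoc] at h2
  exact le_of_mul_le_mul_right h2 hc

/-- ★★ **THE SAME ALONG n06-c's CARRIER `SCMemberY` BY NAME** (`x := j.val`, surjectivity `j.surjective_beta` by construction; INHABITED beyond every threshold by
`B9SectionCarryingMembersV1.exists_scMember_ge`). [cite: Balaban1985BackgroundPropagators, Thm 3.2 (3.48) p.398 + (3.19) p.393 + (3.35) p.396; Balaban1984PropagatorsII, (2.3) p.224 + (2.45) p.231] -/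
theorem conv348_oneCube_parKnitY_at_scMemberY_of_regYR (hN : 1 ≤ N)
    {R₁ R₂ : RegFamY θ.d₆ θ.ℓ₆ θ.hd' θ.hL' θ.b₀ θ.b₁ Mstar (Matrix (Fin N) (Fin N) ℂ)} {c : ℝ} (hc : 0 < c)
    (hRP1 : ∀ (x : MemberY θ.d₆ θ.ℓ₆ θ.hd' θ.hL' θ.b₀ θ.b₁ Mstar) (α₀ : ℝ)
      (U : (bg9YR (Matrix (Fin N) (Fin N) ℂ) (specialUnitaryUnits (Fin N)) R₁ R₂ x).Cfg),
      (bg9YR (Matrix (Fin N) (Fin N) ℂ) (specialUnitaryUnits (Fin N)) R₁ R₂ x).Reg335 c α₀ U →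
        0 ≤ α₀ ∧ (bg9YP (Matrix (Fin N) (Fin N) ℂ) (specialUnitaryUnits (Fin N)) x).Reg335 c35Y α₀ U) :
    ∃ M₁ a₁ B₀ δ₀ : ℝ, 0 < M₁ ∧ 0 < a₁ ∧ 0 < B₀ ∧ 0 < δ₀ ∧
    ∀ (bI : ∀ x : MemberY θ.d₆ θ.ℓ₆ θ.hd' θ.hL' θ.b₀ θ.b₁ Mstar, FBondY x.toKIdx → IBondY x.toKIdx)
      (_hβI : ∀ (x : MemberY θ.d₆ θ.ℓ₆ θ.hd' θ.hL' θ.b₀ θ.b₁ Mstar) (f : FBondY x.toKIdx) (c : IBondY x.toKIdx),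
        blkV1 x.hN x.D f = β x.hN x.D x.hk c → β x.hN x.D x.hk (bI x f) = blkV1 x.hN x.D f)
      (j : SCMemberY θ.d₆ θ.ℓ₆ θ.hd' θ.hL' θ.b₀ θ.b₁ Mstar), M₁ ≤ (geo9Y j.val).M →
      ∀ α₀ : ℝ, 0 < α₀ → c * (geo9Y j.val).M * α₀ ≤ a₁ →
      ∀ U : (bg9YR (Matrix (Fin N) (Fin N) ℂ) (specialUnitaryUnits (Fin N)) R₁ R₂ j.val).Cfg,
        (bg9YR (Matrix (Fin N) (Fin N) ℂ) (specialUnitaryUnits (Fin N)) R₁ R₂ j.val).Reg335 c α₀ U →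
        Conv348Blk (oneCubeOps39 (geo9Y j.val) (bg9YR (Matrix (Fin N) (Fin N) ℂ) (specialUnitaryUnits (Fin N)) R₁ R₂ j.val)
          (blk39F (Matrix (Fin N) (Fin N) ℂ) j.val.toKIdx (bI j.val))
          (L39 j.val.toKIdx (parKnitY j.val.toKIdx) (GpY j.val.toKIdx (parKnitY j.val.toKIdx)))) B₀ δ₀ U := by
  obtain ⟨M₁, a₁, B₀, δ₀, hM₁, ha₁, hB₀, hδ₀, h⟩ := conv348_oneCube_parKnitY_of_regYR_section (N := N) θ Mstar hN hc hRP1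
  exact ⟨M₁, a₁, B₀, δ₀, hM₁, ha₁, hB₀, hδ₀, fun bI hβI j hM α₀ hα ha U hU => h bI hβI j.val j.surjective_beta hM α₀ hα ha U hU⟩

/-- ★★ **THE SAME AT A LETTERS FAMILY WITH THE `G′`-PIN** («KA» is generic in `𝔏` with the displayed pin `(𝔏 x).Gp = GpY x.toKIdx (parKnitY x.toKIdx)`; its `h348`
reads `L39 x.toKIdx (parKnitY x.toKIdx) (𝔏 x).Gp` literally). [cite: Balaban1985BackgroundPropagators, Thm 3.2 (3.48) p.398 + (3.19) p.393 + (3.35) p.396 (bookkeeping: the pin)] -/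
theorem conv348_oneCube_parKnitY_of_regYR_section_letters (hN : 1 ≤ N) (𝔏 : LettersY N θ Mstar)
    (hGp : ∀ x : MemberY θ.d₆ θ.ℓ₆ θ.hd' θ.hL' θ.b₀ θ.b₁ Mstar, (𝔏 x).Gp = GpY x.toKIdx (parKnitY x.toKIdx))
    {R₁ R₂ : RegFamY θ.d₆ θ.ℓ₆ θ.hd' θ.hL' θ.b₀ θ.b₁ Mstar (Matrix (Fin N) (Fin N) ℂ)} {c : ℝ} (hc : 0 < c)
    (hRP1 : ∀ (x : MemberY θ.d₆ θ.ℓ₆ θ.hd' θ.hL' θ.b₀ θ.b₁ Mstar) (α₀ : ℝ)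
      (U : (bg9YR (Matrix (Fin N) (Fin N) ℂ) (specialUnitaryUnits (Fin N)) R₁ R₂ x).Cfg),
      (bg9YR (Matrix (Fin N) (Fin N) ℂ) (specialUnitaryUnits (Fin N)) R₁ R₂ x).Reg335 c α₀ U →
        0 ≤ α₀ ∧ (bg9YP (Matrix (Fin N) (Fin N) ℂ) (specialUnitaryUnits (Fin N)) x).Reg335 c35Y α₀ U) :
    ∃ M₁ a₁ B₀ δ₀ : ℝ, 0 < M₁ ∧ 0 < a₁ ∧ 0 < B₀ ∧ 0 < δ₀ ∧
    ∀ (bI : ∀ x : MemberY θ.d₆ θ.ℓ₆ θ.hd' θ.hL' θ.b₀ θ.b₁ Mstar, FBondY x.toKIdx → IBondY x.toKIdx)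
      (_hβI : ∀ (x : MemberY θ.d₆ θ.ℓ₆ θ.hd' θ.hL' θ.b₀ θ.b₁ Mstar) (f : FBondY x.toKIdx) (c : IBondY x.toKIdx),
        blkV1 x.hN x.D f = β x.hN x.D x.hk c → β x.hN x.D x.hk (bI x f) = blkV1 x.hN x.D f)
      (x : MemberY θ.d₆ θ.ℓ₆ θ.hd' θ.hL' θ.b₀ θ.b₁ Mstar), Function.Surjective (β x.hN x.D x.hk) → M₁ ≤ (geo9Y x).M →
      ∀ α₀ : ℝ, 0 < α₀ → c * (geo9Y x).M * α₀ ≤ a₁ →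
      ∀ U : (bg9YR (Matrix (Fin N) (Fin N) ℂ) (specialUnitaryUnits (Fin N)) R₁ R₂ x).Cfg,
        (bg9YR (Matrix (Fin N) (Fin N) ℂ) (specialUnitaryUnits (Fin N)) R₁ R₂ x).Reg335 c α₀ U →
        Conv348Blk (oneCubeOps39 (geo9Y x) (bg9YR (Matrix (Fin N) (Fin N) ℂ) (specialUnitaryUnits (Fin N)) R₁ R₂ x)
          (blk39F (Matrix (Fin N) (Fin N) ℂ) x.toKIdx (bI x)) (L39 x.toKIdx (parKnitY x.toKIdx) (𝔏 x).Gp)) B₀ δ₀ U := by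
  obtain ⟨M₁, a₁, B₀, δ₀, hM₁, ha₁, hB₀, hδ₀, h⟩ := conv348_oneCube_parKnitY_of_regYR_section (N := N) θ Mstar hN hc hRP1
  refine ⟨M₁, a₁, B₀, δ₀, hM₁, ha₁, hB₀, hδ₀, fun bI hβI x hsurj hM α₀ hα ha U hU => ?_⟩
  rw [hGp x]
  exact h bI hβI x hsurj hM α₀ hα ha U hU

end Record

end Literature.MathematicalPhysics.QuantumFieldTheory.Balaban1983to89.B9Thm32Conv348AtKnitLetterOfRegYP335

end
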